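import Literature.MathematicalPhysics.QuantumFieldTheory.BalabanImbrieJaffe1984to88.BIJ85RT37Normalization

/-!
# `BalabanImbrieJaffe1984to88.BIJ88RT311` — T. Bałaban, J. Imbrie, A. Jaffe, *Effective action and cluster properties of the abelian
Higgs model*, Commun. Math. Phys. **114** (1988) 257–315 [BalabanImbrieJaffe1988], pp. 266–267: the first renormalization transformation
— the density **(3.11)** `ρ₁^L(v, ψ)` (with the constant **(3.12)** `E^{(0)}`) TYPED, and its normalization **(3.13)** `[F] = ∫dv dψ ρ₁^L(v, ψ)`
PROVED, as the instance of the measure-level transformation 𝒯 of [BalabanImbrieJaffe1985] (3.3) (`BIJ85RT33`, file 1/3 of this seat) and of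
its normalization property (3.7) (`BIJ85RT37Normalization`, file 2/3) at the density `ρ₀` of (3.6)–(3.7) (`BIJ88Sect3Rescaling.bracket_rescale`,
seat p34 gen 1) and the L-lattice Gaussian of (3.11)–(3.12) (`BIJ88Sect3Normalization.blockGaussian_integral_eq_one`, r18).

statement-level skeleton of published theorems with citation tags; proofs where landed; nothing here is a claim about the Yang–Mills mass gap

PDF held: `paper:balaban1988-cmp114-bij-abelian-higgs-effective-action` (journal page = PDF page + 256); p. 266 [PDF 10] and p. 267 [PDF 11]
read on the renders `HOME/lit-balaban-r18/renders/c2/c2-p010b.png`, `run/sessions/literature-prover-lit-balaban-p34-g2-0/folder/pages/c2-p011a.png`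
(poppler ×3).

CITATION HEADER (lean-in-tree rule).  Part of the lit-balaban TYPED SKELETON (HOME `run/shared/lean/pub/lit-balaban/`), PHASE-2 proof seat p34
(gen 2, unit `lit-balaban-p34-g2`; TAKING line HOME/STATUS.md 2026-08-21T02:58Z).  Rows served: `C2.Eq3.11` (typed: `rho1L`), `C2.Eq3.13`
(PROVED: `eq313`) of `HOME/lit-balaban-r18/ROWS-C2.md` (owner r18, whose gen-2 HANDOFF left them *"for a successor … ρ₁^L := Radon–Nikodym
density of the pushforward … cf. `AveragingRT.rnTransport`"*); row `C2.Eq3.12` (r18: `BIJ88Sect3Statements.E0step`, normalizing property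
`BIJ88Sect3Normalization.blockGaussian_integral_eq_one`) is USED.

THE PRINTED TEXT (pp. 266–267 [PDF 10–11], verbatim).  *"We begin to compute [F] by integrating over u, φ under constraints given by the block
fields v, ψ on the L-lattice. This is the renormalization transformation, described in the previous paper. With the gauge fix δ_{Ax}(u), it
takes the density ρ₀(u, φ) to
ρ₁^L(v, ψ) = ∫ 𝒟u𝒟φ δ(v/Qu) δ_{Ax}(u) F exp[ − Σ_p e₀^{−2}(1 − Re u(p)) − ½aL^{−2}⟨ψ − Q(u)φ, ψ − Q(u)φ⟩ − ½⟨φ, −Δ_uφ⟩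
  − Σ_x P₀(φ(x)) − Σ_x ½δm²ε²|φ(x)|² − ℰ₀ − E^{(0)} − E₁].   (3.11)
Here we define E^{(0)} = −|T₁^{(1)}| log(aL^{d−2}/2π), (3.12) which normalizes the transformation so that [F] = ∫dv dψ ρ₁^L(v, ψ). (3.13)"*

HOW IT IS TYPED.  By (3.6)–(3.7) (`BIJ88Sect3Rescaling.bracket_rescale`: `[F] = ∫𝒟u𝒟φ ρ₀(u, φ)`), the integrand of (3.11) is
`δ(v/Qu) δ_{Ax}(u) ρ₀(u, φ) exp[−½aL^{−2}⟨ψ − Q(u)φ, ψ − Q(u)φ⟩ − E^{(0)}]`, with `ρ₀ = F exp[−Σ_p e₀^{−2}(1 − Re u(p)) − ½⟨φ, −Δ_uφ⟩ − Σ_x P₀(φ(x))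
− Σ_x ½δm²ε²|φ(x)|² − ℰ₀ − E₁]` — here `rho0`, the integrand of `bracket_rescale` (C1's unit-lattice action (1.1) with `e₀ = e(ε)`, `λ₀ = λ(ε)`,
mass term `(1 + 2δm²)ε²`, constant `ℰ₀ + E₁ + |T₁|ε^d/(64λ)`, `F` at the rescaled field; the sign bookkeeping of the `δm²` term is the one OF
RECORD in `BIJ88Sect3Rescaling.selfInt_rescale_eq_Pk` / HOME/GAPS.md G-C2-01, nothing new here) — and the L-lattice inner product carries the weight
`L^d` per site (`⟨f, f⟩ = Σ_{y∈T₁^{(1)}} L^d|f(y)|²`, the convention under which (3.12) normalizes: r18's `blockGaussian_integral_eq_one`).  So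
(3.11) IS [BalabanImbrieJaffe1985] (3.3) applied to `ρ₀` with the approximate δ-function `δ_H(ψ − c) = exp[−½aL^{−2}⟨ψ − c, ψ − c⟩ − E^{(0)}]`
(`gaussL`, an `ApproxDelta` by (3.12)): `rho1L D … := D.rt (gaussL …) (rho0 …)` over the block-averaging datum `D : BIJ85RT33.RTData P j`
((3.4) axial trees, (2.10) `Qu`, (2.6) `Q(u)φ` of *"the previous paper"* as measurable maps with the Haar regularity of `Qu` in the axial gauge
— see `BIJ85RT33`; the concrete torus instances are NOT built here), `L = P.L`, `d = P.d` (`Balaban1983to89.Setup`), levels `j` (the unit lattice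
`T₁`) and `j + 1` (the L-lattice `T₁^{(1)}`).
WHAT IS PROVED.  **(3.13)** `eq313`: for every `D`, `a > 0`, `d ≥ 2`, `ε > 0` and every observable `F` that is jointly measurable, jointly gauge
invariant (p. 265: *"F is a gauge-invariant function"*; `BIJ85RT33.JointInvariant`) and such that `ρ₀ ∈ L¹(𝒟u𝒟φ)` (the unnormalized expectation
converges absolutely), `[F] = bracket (actionU1 (ε^d) ε⁻¹ e λ δm² E₀ E₁) F = ∫𝒟v ∫𝒟ψ ρ₁^L(v, ψ)` — from (3.6) (`eq36` = gen-1's `bracket_rescale`)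
and (3.7) of the previous paper (`BIJ85RT37Normalization.integral_rt`), whose hypotheses are discharged here: joint measurability of `ρ₀`
(`measurable_rho0`: the action is a measurable function of `(u, φ)`) and joint gauge invariance of `ρ₀` (`jointInvariant_rho0`: C1's
`BIJ85Sect1Model.action_gauge` transported through `BIJ88Sect3Rescaling.fieldEquiv`, and `F`'s).  Also the (3.12) facts making `gaussL` an
approximate δ-function.
NOT DONE HERE.  (3.22) (the same density after the decomposition (3.14)–(3.21); bookkeeping display, row absent); the concrete (2.6)/(2.10)/(3.4)
on the torus; any bound.  Imports: file 2/3 only; no `Prop`-valued facts introduced; standard axioms.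
-/

namespace Literature.MathematicalPhysics.QuantumFieldTheory.BalabanImbrieJaffe1984to88.BIJ88RT311

open Literature.MathematicalPhysics.QuantumFieldTheory.Balaban1983to89
open BIJ88Sect3Statements (U1 toC toC_mul toC_inv cfg bracket actionU1 calE0 E0step)
open BIJ85Sect1Model (HiggsField U1Field eEps lamEps)
open BIJ88Sect3Rescaling (circleEquivU1 coe_circleEquivU1_symm fieldEquiv fieldEquiv_symm_apply phiScale bracket_rescale)
open BIJ85RT33 BIJ85RT33.RTData BIJ85RT33.ApproxDelta BIJ85RT37Normalization
open GaugeField (gaugeAct GaugeInvariant)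
open scoped BigOperators ENNReal
open _root_.MeasureTheory _root_.MeasureTheory.Measure Complex

noncomputable section
open Classical

variable {P : Params} {j : ℕ}

/-! ## §1 (3.6)–(3.7): the density `ρ₀` on the unit lattice -/

/-- The exponent of **(3.7)** p. 266 without `F`: `Σ_{p∈T₁**} e₀⁻²(1 − Re u(p)) + ½⟨φ, −Δ_uφ⟩ + Σ_x P₀(φ(x)) + Σ_x ½δm²ε²|φ(x)|² + ℰ₀ + E₁` AS OF
RECORD, i.e. C1's unit-lattice action (1.1) with `e₀ = e(ε)`, `λ₀ = λ(ε)`, mass term `(1 + 2δm²)ε²` and constant `ℰ₀ + E₁ + |T₁|ε^d/(64λ)` at the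
configuration read through `BIJ88Sect3Rescaling.fieldEquiv` (the exponent of `BIJ88Sect3Rescaling.bracket_rescale`; term-by-term reading and the
`δm²`-sign note: `BIJ88Sect3Rescaling.selfInt_rescale_eq_Pk`, HOME/GAPS.md G-C2-01). [cite: BalabanImbrieJaffe1988, (3.7) p.266] -/
def S1 (ε e lam dm2 E₀ E₁ : ℝ) (U : GaugeField P j U1) (φ : HiggsField P j) : ℝ :=
  BIJ85Sect1Model.action (eEps e ε P.d) (lamEps lam ε P.d) ((1 + 2 * dm2) * ε ^ 2)
    (calE0 E₀ P.d (Fintype.card (Balaban1983to89.Site P j)) ε + E₁ +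
      Fintype.card (Balaban1983to89.Site P j) * ε ^ P.d / (64 * lam)) (fieldEquiv.symm U) φ

/-- **(3.7)** p. 266 [PDF 10], verbatim: *"ρ₀(u, φ) = F exp[−Σ_{p∈T₁**} e₀⁻²(1 − Re u(p)) − ½⟨φ, −Δ_uφ⟩ − Σ_{x∈T₁} P₀(φ(x)) − Σ_{x∈T₁} ½δm²ε²|φ(x)|²
− ℰ₀ − E₁]. (3.7) … Each factor φ in F acquires a factor ε^{−(d−2)/2}, but we use the same notation."* — as a function of the `U(1)` configuration
and the unit-lattice scalar field: `F(u, ε^{−(d−2)/2}φ) e^{−S₁(u, φ)}` with `S₁` = `S1` (the integrand of `BIJ88Sect3Rescaling.bracket_rescale`).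
[cite: BalabanImbrieJaffe1988, (3.7) p.266] -/
def rho0 (ε e lam dm2 E₀ E₁ : ℝ) (F : GaugeField P j U1 → HiggsField P j → ℂ) (U : GaugeField P j U1) (φ : HiggsField P j) : ℂ :=
  (Real.exp (-(S1 ε e lam dm2 E₀ E₁ U φ)) : ℂ) * F U (phiScale ε P.d • φ)

/-- **(3.6)** p. 266 [PDF 10], verbatim: *"[F] = ∫𝒟u𝒟φ ρ₀(u, φ), (3.6)"* — for the typed (3.1) `bracket` of the action (3.3) on `T_ε`
(`w = ε^d`, `c = ε⁻¹`): gen-1's `BIJ88Sect3Rescaling.bracket_rescale` with the density named `rho0`. [cite: BalabanImbrieJaffe1988, (3.6) p.266] -/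
theorem eq36 {ε : ℝ} (hε : 0 < ε) (e lam dm2 E₀ E₁ : ℝ) (F : GaugeField P j U1 → HiggsField P j → ℂ) :
    bracket (actionU1 (ε ^ P.d) ε⁻¹ e lam dm2 E₀ E₁) F = ∫ U, (∫ φ, rho0 ε e lam dm2 E₀ E₁ F U φ) ∂fieldMeasure P j U1 :=
  bracket_rescale hε e lam dm2 E₀ E₁ F

/-! ### `ρ₀` is jointly gauge invariant (for gauge-invariant `F`) -/

/-- kernel: C2's gauge transformation of the `U(1)` configuration (`Setup`'s `gaugeAct` by `h : T₁ → U(1)`), read through `fieldEquiv`, IS C1's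
(2.7) `u_b → h(b₋)h(b₊)⁻¹u_b` (`BIJ85Sect1Model.gaugeU`, `Circle`-valued `h`). [cite: BalabanImbrieJaffe1988, (4.16) p.276] -/
theorem fieldEquiv_symm_gaugeAct (g : GaugeTransf P j U1) (U : GaugeField P j U1) :
    fieldEquiv.symm (gaugeAct g U) = BIJ85Sect1Model.gaugeU (fun x => circleEquivU1.symm (g x)) (fieldEquiv.symm U) := by
  funext b
  simp only [fieldEquiv_symm_apply, GaugeField.gaugeAct, BIJ85Sect1Model.gaugeU, map_mul, map_inv]
  exact mul_right_comm _ _ _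

/-- kernel: `φ ↦ hφ` (`BIJ85RT33.twist`) IS C1's (2.7) `φ_y → h(y)φ_y` (`BIJ85Sect1Model.gaugeHiggs`). [cite: BalabanImbrieJaffe1988, (4.16) p.276] -/
theorem twist_eq_gaugeHiggs (g : GaugeTransf P j U1) (φ : HiggsField P j) :
    twist g φ = BIJ85Sect1Model.gaugeHiggs (fun x => circleEquivU1.symm (g x)) φ := by
  funext x
  simp [twist, BIJ85Sect1Model.gaugeHiggs, coe_circleEquivU1_symm]

/-- kernel: the field rescaling commutes with gauge transformations, `ε^{−(d−2)/2}(hφ) = h(ε^{−(d−2)/2}φ)`. [cite: BalabanImbrieJaffe1988, (3.6) p.266] -/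
theorem smul_twist (s : ℝ) (g : GaugeTransf P j U1) (φ : HiggsField P j) : s • twist g φ = twist g (s • φ) := by
  funext x
  simp only [Pi.smul_apply, twist_apply, Complex.real_smul]
  ring

/-- kernel: the exponent of (3.7) is jointly gauge invariant — C1's `BIJ85Sect1Model.action_gauge` transported to the carrier of record.
[cite: BalabanImbrieJaffe1988, (3.7) p.266] -/
theorem S1_gauge (ε e lam dm2 E₀ E₁ : ℝ) (g : GaugeTransf P j U1) (U : GaugeField P j U1) (φ : HiggsField P j) :
    S1 ε e lam dm2 E₀ E₁ (gaugeAct g U) (twist g φ) = S1 ε e lam dm2 E₀ E₁ U φ := by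
  unfold S1
  rw [fieldEquiv_symm_gaugeAct, twist_eq_gaugeHiggs, BIJ85Sect1Model.action_gauge]

/-- **`ρ₀` is jointly gauge invariant** whenever `F` is (p. 265: *"F is a gauge-invariant function"*; p. 258: *"We use the Wilson form of lattice
action, which is gauge invariant"*). [cite: BalabanImbrieJaffe1988, (3.7) p.266] -/
theorem jointInvariant_rho0 (ε e lam dm2 E₀ E₁ : ℝ) {F : GaugeField P j U1 → HiggsField P j → ℂ} (hF : JointInvariant F) :
    JointInvariant (rho0 ε e lam dm2 E₀ E₁ F) := by
  intro g U φ
  simp only [rho0, S1_gauge, smul_twist, hF g U]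

/-- kernel: a unit complex number is the exponential of `i` times its argument, `toC g = e^{i arg(toC g)}` — every `h : T₁ → U(1)` is of the
form `e^{iλ}` with the real phase `λ = arg h`. [cite: BalabanImbrieJaffe1988, (4.16) p.276] -/
theorem exp_arg_toC (g : U1) : exp (((toC g).arg : ℂ) * I) = toC g := by
  have h := Complex.norm_mul_exp_arg_mul_I (toC g)
  rwa [BIJ88Sect3Statements.norm_toC, Complex.ofReal_one, one_mul] at h

/-- kernel: the gauge transformation by `h : T₁ → U(1)` of the configuration, read in `ℂ` (`cfg`), IS C2's phase form
`u(b) ↦ e^{iλ(b₋)}u(b)e^{−iλ(b₊)}` (`BIJ88Sect3Statements.gaugeU`) with `λ = arg h`. [cite: BalabanImbrieJaffe1988, (4.16) p.276] -/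
theorem cfg_gaugeAct (g : GaugeTransf P j U1) (U : GaugeField P j U1) :
    cfg (gaugeAct g U) = BIJ88Sect3Statements.gaugeU (fun x => (toC (g x)).arg) (cfg U) := by
  funext b
  have htgt : exp (-(((toC (g b.tgt)).arg : ℂ) * I)) = (starRingEnd ℂ) (toC (g b.tgt)) := by
    rw [← exp_arg_toC (g b.tgt), ← Complex.exp_conj, exp_arg_toC]
    congr 1
    rw [map_mul, Complex.conj_ofReal, Complex.conj_I, mul_neg]
  simp only [cfg, GaugeField.gaugeAct, BIJ88Sect3Statements.gaugeU, toC_mul, toC_inv, exp_arg_toC, htgt]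

/-- kernel: likewise `hφ` (`BIJ85RT33.twist`) IS C2's `φ(x) ↦ e^{iλ(x)}φ(x)` (`BIJ88Sect3Statements.gaugePhi`) with `λ = arg h`.
[cite: BalabanImbrieJaffe1988, (4.16) p.276] -/
theorem twist_eq_gaugePhi (g : GaugeTransf P j U1) (φ : HiggsField P j) :
    twist g φ = BIJ88Sect3Statements.gaugePhi (fun x => (toC (g x)).arg) φ := by
  funext x
  simp only [twist_apply, BIJ88Sect3Statements.gaugePhi, exp_arg_toC]

/-- **Gauge-invariant observables in C2's own vocabulary are jointly gauge invariant**: if `F′(u, φ)` — a function of the ℂ-valued bond field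
`u = cfg U` and of `φ` — is `BIJ88Sect3Statements.IsGaugeInvariant` (invariance under the phase transformations `gaugeU λ`, `gaugePhi λ`; e.g.
products of the loop variables (1.1) and string variables (1.2), `BIJ88Sect3Statements.loopVar_gauge` / `stringVar_gauge`, and of the action,
`action_gauge`), then `(U, φ) ↦ F′(cfg U, φ)` is `JointInvariant`, so (3.13) below applies to it (p. 265: *"F is a gauge-invariant function, a
product of terms like |φ(x)|², \overline{φ}(b₋)u(b)φ(b₊), Re(ieε²)⁻¹(u(p) − 1)"*). [cite: BalabanImbrieJaffe1988, (3.1) p.265] -/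
theorem jointInvariant_of_isGaugeInvariant {α : Type*} {F' : (PBond P j → ℂ) → HiggsField P j → α}
    (hF' : BIJ88Sect3Statements.IsGaugeInvariant F') : JointInvariant (fun U φ => F' (cfg U) φ) := by
  intro g U φ
  simp only [cfg_gaugeAct, twist_eq_gaugePhi]
  exact hF' _ _ _

/-! ### `ρ₀` is jointly measurable (for measurable `F`) -/

/-- kernel: a bond variable read in `ℂ`, `(u, φ) ↦ u(b) = toC (U b)`, is jointly measurable. [cite: BalabanImbrieJaffe1988, (3.3) p.265] -/
theorem measurable_bond (b : PBond P j) : Measurable fun p : GaugeField P j U1 × HiggsField P j => ((fieldEquiv.symm p.1 b : Circle) : ℂ) := by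
  have h : (fun p : GaugeField P j U1 × HiggsField P j => ((fieldEquiv.symm p.1 b : Circle) : ℂ)) = fun p => toC (p.1 b) := by
    funext p
    simp [fieldEquiv_symm_apply, coe_circleEquivU1_symm]
  rw [h]
  exact measurable_toC.comp ((measurable_pi_apply b).comp measurable_fst)

/-- kernel: a site variable `(u, φ) ↦ φ(x)` is jointly measurable. [cite: BalabanImbrieJaffe1988, (3.3) p.265] -/
theorem measurable_site (x : Balaban1983to89.Site P j) : Measurable fun p : GaugeField P j U1 × HiggsField P j => p.2 x :=
  (measurable_pi_apply x).comp measurable_snd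

/-- kernel: the Wilson term `1 − Re u(p)` is a jointly measurable function of the configuration. [cite: BalabanImbrieJaffe1988, (3.3) p.265] -/
theorem measurable_plaq (q : Balaban1983to89.Plaq P j) :
    Measurable fun p : GaugeField P j U1 × HiggsField P j => ((BIJ85Sect1Model.plaq (fieldEquiv.symm p.1) q : Circle) : ℂ).re := by
  have h : ∀ p : GaugeField P j U1 × HiggsField P j, ((BIJ85Sect1Model.plaq (fieldEquiv.symm p.1) q : Circle) : ℂ) =
      ((fieldEquiv.symm p.1 ⟨q.src, q.μ⟩ : Circle) : ℂ) * ((fieldEquiv.symm p.1 ⟨q.src.shift q.μ, q.ν⟩ : Circle) : ℂ) *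
        (starRingEnd ℂ) ((fieldEquiv.symm p.1 ⟨q.src.shift q.ν, q.μ⟩ : Circle) : ℂ) *
        (starRingEnd ℂ) ((fieldEquiv.symm p.1 ⟨q.src, q.ν⟩ : Circle) : ℂ) := fun p => by
    simp only [BIJ85Sect1Model.plaq, Circle.coe_mul, Circle.coe_inv_eq_conj]
  simp_rw [h]
  exact Complex.measurable_re.comp ((((measurable_bond _).mul (measurable_bond _)).mul
    (Complex.continuous_conj.measurable.comp (measurable_bond _))).mul (Complex.continuous_conj.measurable.comp (measurable_bond _)))

/-- kernel: the covariant derivative `(D_uφ)_b = u_bφ_{b₊} − φ_{b₋}` is jointly measurable. [cite: BalabanImbrieJaffe1988, (3.3) p.265] -/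
theorem measurable_covDeriv (b : PBond P j) :
    Measurable fun p : GaugeField P j U1 × HiggsField P j => BIJ85Sect1Model.covDeriv (fieldEquiv.symm p.1) p.2 b := by
  unfold BIJ85Sect1Model.covDeriv
  exact ((measurable_bond b).mul (measurable_site _)).sub (measurable_site _)

/-- kernel: the exponent `S₁(u, φ)` of (3.7) is a jointly measurable function of `(u, φ)` (finite sums of measurable terms).
[cite: BalabanImbrieJaffe1988, (3.7) p.266] -/
theorem measurable_S1 (ε e lam dm2 E₀ E₁ : ℝ) : Measurable (Function.uncurry (S1 (P := P) (j := j) ε e lam dm2 E₀ E₁)) := by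
  have e1 : Function.uncurry (S1 (P := P) (j := j) ε e lam dm2 E₀ E₁) = fun p : GaugeField P j U1 × HiggsField P j =>
      (∑ q : Balaban1983to89.Plaq P j, (eEps e ε P.d)⁻¹ ^ 2 * (1 - ((BIJ85Sect1Model.plaq (fieldEquiv.symm p.1) q : Circle) : ℂ).re)) +
        (1 / 2) * (∑ b : PBond P j, ‖BIJ85Sect1Model.covDeriv (fieldEquiv.symm p.1) p.2 b‖ ^ 2) +
        (∑ x : Balaban1983to89.Site P j, BIJ85Sect1Model.selfInt (lamEps lam ε P.d) ((1 + 2 * dm2) * ε ^ 2) (p.2 x)) +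
        (calE0 E₀ P.d (Fintype.card (Balaban1983to89.Site P j)) ε + E₁ +
          Fintype.card (Balaban1983to89.Site P j) * ε ^ P.d / (64 * lam)) := by
    funext p
    rfl
  rw [e1]
  refine ((Measurable.add ?_ ?_).add ?_).add measurable_const
  · refine Finset.measurable_sum _ fun q _ => ?_
    exact measurable_const.mul (measurable_const.sub (measurable_plaq q))
  · refine measurable_const.mul (Finset.measurable_sum _ fun b _ => ?_)
    exact (measurable_covDeriv b).norm.pow_const 2
  · refine Finset.measurable_sum _ fun x _ => ?_
    unfold BIJ85Sect1Model.selfInt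
    exact (measurable_const.mul ((measurable_site x).norm.pow_const 4)).sub
      ((measurable_const.mul measurable_const).mul ((measurable_site x).norm.pow_const 2))

/-- **`ρ₀` is jointly measurable** whenever `F` is. [cite: BalabanImbrieJaffe1988, (3.7) p.266] -/
theorem measurable_rho0 (ε e lam dm2 E₀ E₁ : ℝ) {F : GaugeField P j U1 → HiggsField P j → ℂ} (hF : Measurable (Function.uncurry F)) :
    Measurable (Function.uncurry (rho0 ε e lam dm2 E₀ E₁ F)) := by
  have e1 : Function.uncurry (rho0 ε e lam dm2 E₀ E₁ F) = fun p : GaugeField P j U1 × HiggsField P j =>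
      (Real.exp (-(Function.uncurry (S1 ε e lam dm2 E₀ E₁) p)) : ℂ) * Function.uncurry F (p.1, phiScale ε P.d • p.2) := by
    funext p
    rfl
  rw [e1]
  have hs : Measurable fun p : GaugeField P j U1 × HiggsField P j => (p.1, phiScale ε P.d • p.2) :=
    measurable_fst.prodMk ((measurable_const_smul (phiScale ε P.d)).comp measurable_snd)
  exact (Complex.measurable_ofReal.comp (Real.measurable_exp.comp (measurable_S1 ε e lam dm2 E₀ E₁).neg)).mul (hF.comp hs)

/-! ## §2 (3.11)–(3.12): the L-lattice Gaussian `exp[−½aL⁻²⟨ψ − Q(u)φ, ψ − Q(u)φ⟩ − E^{(0)}]` is an approximate δ-function -/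

/-- The block-field Gaussian factor of **(3.11)** with the constant **(3.12)**: `exp[−½aL^{−2}⟨ψ − c, ψ − c⟩ − E^{(0)}]`, the L-lattice inner
product `⟨f, f⟩ = Σ_{y∈T₁^{(1)}} L^d|f(y)|²`, `E^{(0)} = −|T₁^{(1)}| log(aL^{d−2}/2π)` (`BIJ88Sect3Statements.E0step`), `L = P.L`, `d = P.d`; centre
`c = Q(u)φ`. [cite: BalabanImbrieJaffe1988, (3.11) p.266] -/
def gaussLKernel (a : ℝ) (c ψ : HiggsField P (j + 1)) : ℝ :=
  Real.exp (-(1 / 2) * (a * (P.L : ℝ)⁻¹ ^ 2) * (∑ y, (P.L : ℝ) ^ P.d * ‖ψ y - c y‖ ^ 2)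
    - E0step (Fintype.card (Balaban1983to89.Site P (j + 1))) a P.L P.d)

/-- kernel: the Gaussian factor is jointly measurable in `(c, ψ)`. [cite: BalabanImbrieJaffe1988, (3.11) p.266] -/
theorem measurable_gaussLKernel (a : ℝ) : Measurable (Function.uncurry (gaussLKernel (P := P) (j := j) a)) := by
  have e1 : Function.uncurry (gaussLKernel (P := P) (j := j) a) = fun p : HiggsField P (j + 1) × HiggsField P (j + 1) =>
      Real.exp (-(1 / 2) * (a * (P.L : ℝ)⁻¹ ^ 2) * (∑ y, (P.L : ℝ) ^ P.d * ‖p.2 y - p.1 y‖ ^ 2)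
        - E0step (Fintype.card (Balaban1983to89.Site P (j + 1))) a P.L P.d) := by
    funext p
    rfl
  rw [e1]
  refine Real.measurable_exp.comp (Measurable.sub (measurable_const.mul (Finset.measurable_sum _ fun y _ => ?_)) measurable_const)
  exact measurable_const.mul ((((measurable_pi_apply y).comp measurable_snd).sub ((measurable_pi_apply y).comp measurable_fst)).norm.pow_const 2)

/-- kernel: the Gaussian factor is positive. [cite: BalabanImbrieJaffe1988, (3.11) p.266] -/
theorem gaussLKernel_pos (a : ℝ) (c ψ : HiggsField P (j + 1)) : 0 < gaussLKernel a c ψ := Real.exp_pos _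

/-- **(3.12)** p. 267 [PDF 11], verbatim: *"Here we define E^{(0)} = −|T₁^{(1)}| log(aL^{d−2}/2π), (3.12) which normalizes the transformation"*:
`∫dψ exp[−½aL^{−2}⟨ψ − c, ψ − c⟩ − E^{(0)}] = 1` for every centre (`a > 0`, `d ≥ 2`; `L = P.L > 1`) — r18's
`BIJ88Sect3Normalization.blockGaussian_integral_eq_one` on the block-field space `HiggsField P (j + 1)`. [cite: BalabanImbrieJaffe1988, (3.12) p.267] -/
theorem integral_gaussLKernel {a : ℝ} (ha : 0 < a) (hd : 2 ≤ P.d) (c : HiggsField P (j + 1)) : ∫ ψ, gaussLKernel a c ψ = 1 := by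
  have hL : (0 : ℝ) < P.L := by exact_mod_cast P.L_pos
  exact BIJ88Sect3Normalization.blockGaussian_integral_eq_one ha hL hd c

/-- The Gaussian of (3.11)–(3.12) IS an approximate δ-function in the sense of [BalabanImbrieJaffe1985] p. 306 (`BIJ85RT33.ApproxDelta`:
measurable, non-negative, unit mass). [cite: BalabanImbrieJaffe1988, (3.12) p.267] -/
def gaussL {a : ℝ} (ha : 0 < a) (hd : 2 ≤ P.d) : ApproxDelta P j where
  K := gaussLKernel a
  measurable_K := measurable_gaussLKernel a
  K_nonneg c ψ := (gaussLKernel_pos a c ψ).le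
  integral_K := integral_gaussLKernel ha hd

/-- kernel: the kernel of `gaussL` is the Gaussian of (3.11)–(3.12). [cite: BalabanImbrieJaffe1988, (3.12) p.267] -/
@[simp] theorem gaussL_K {a : ℝ} (ha : 0 < a) (hd : 2 ≤ P.d) : (gaussL (P := P) (j := j) ha hd).K = gaussLKernel a := rfl

/-! ## §3 (3.11) and (3.13) -/

/-- **(3.11)** p. 266 [PDF 10], verbatim: *"With the gauge fix δ_{Ax}(u), it takes the density ρ₀(u, φ) to
ρ₁^L(v, ψ) = ∫ 𝒟u𝒟φ δ(v/Qu) δ_{Ax}(u) F exp[−Σ_p e₀^{−2}(1 − Re u(p)) − ½aL^{−2}⟨ψ − Q(u)φ, ψ − Q(u)φ⟩ − ½⟨φ, −Δ_uφ⟩ − Σ_x P₀(φ(x))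
− Σ_x ½δm²ε²|φ(x)|² − ℰ₀ − E^{(0)} − E₁]. (3.11)"* — the renormalization transformation of *"the previous paper"* ([BalabanImbrieJaffe1985] (3.3),
`BIJ85RT33.RTData.rt`: `δ_{Ax}(u)𝒟u` = the law of the tree-frozen field, `δ(v/Qu)` = Radon–Nikodym density of the pushed-forward law w.r.t. `dv dψ`)
applied to `ρ₀` (3.7) with the Gaussian `exp[−½aL^{−2}⟨ψ − Q(u)φ, ψ − Q(u)φ⟩ − E^{(0)}]` (3.12) as `δ_H`; over the block-averaging datum `D`
((3.4) [C1] axial trees, (2.10) [C1] `Qu`, (2.6) [C1] `Q(u)φ`), `a > 0`, `d = P.d ≥ 2`, `L = P.L`. [cite: BalabanImbrieJaffe1988, (3.11) p.266] -/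
def rho1L (D : RTData P j) {a : ℝ} (ha : 0 < a) (hd : 2 ≤ P.d) (ε e lam dm2 E₀ E₁ : ℝ) (F : GaugeField P j U1 → HiggsField P j → ℂ) :
    GaugeField P (j + 1) U1 → HiggsField P (j + 1) → ℂ :=
  D.rt (gaussL ha hd) (rho0 ε e lam dm2 E₀ E₁ F)

/-- **(3.13)** p. 267 [PDF 11], verbatim: *"Here we define E^{(0)} = −|T₁^{(1)}| log(aL^{d−2}/2π), (3.12) which normalizes the transformation so
that [F] = ∫dv dψ ρ₁^L(v, ψ). (3.13)"* — PROVED for the typed unnormalized expectation (3.1) `bracket` of the action (3.3) on `T_ε` (`w = ε^d`,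
`c = ε⁻¹`, `ε > 0`) and the typed (3.11) `rho1L`, for every block-averaging datum `D`, `a > 0`, `d = P.d ≥ 2`, and every observable `F` that is
jointly measurable, jointly gauge invariant (p. 265: *"F is a gauge-invariant function"*) and for which `ρ₀ ∈ L¹(𝒟u𝒟φ)`; `dv` = the product Haar
probability measure `fieldMeasure P (j + 1) U1`, `dψ` = Lebesgue measure on `ℂ^{T₁^{(1)}}`.  Assembly: (3.6) `eq36` and the normalization (3.7) of the
previous paper, `BIJ85RT37Normalization.integral_rt`, at `ρ₀` (`measurable_rho0`, `jointInvariant_rho0`) and the (3.12)-normalized Gaussian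
`gaussL`. [cite: BalabanImbrieJaffe1988, (3.13) p.267] -/
theorem eq313 (D : RTData P j) {a : ℝ} (ha : 0 < a) (hd : 2 ≤ P.d) {ε : ℝ} (hε : 0 < ε) (e lam dm2 E₀ E₁ : ℝ)
    (F : GaugeField P j U1 → HiggsField P j → ℂ) (hFm : Measurable (Function.uncurry F)) (hFg : JointInvariant F)
    (hFi : Integrable (Function.uncurry (rho0 ε e lam dm2 E₀ E₁ F)) ((fieldMeasure P j U1).prod volume)) :
    bracket (actionU1 (ε ^ P.d) ε⁻¹ e lam dm2 E₀ E₁) F =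
      ∫ V, (∫ ψ, rho1L D ha hd ε e lam dm2 E₀ E₁ F V ψ) ∂fieldMeasure P (j + 1) U1 := by
  rw [eq36 hε, rho1L, integral_rt D (gaussL ha hd) _ (measurable_rho0 ε e lam dm2 E₀ E₁ hFm) (jointInvariant_rho0 ε e lam dm2 E₀ E₁ hFg) hFi]

/-! ## §4 Non-vacuity: the block-averaging data type is inhabited on the torus -/

/-- NON-VACUITY CERTIFICATE for the hypotheses of (3.13)/(3.7) [C1]: the DECIMATION datum — no bond frozen (`T = ∅`, trivially tree-like),
`Qu` := the straight-line transport average `Balaban1983to89.AveragingRT.axialAvg` (Haar-COMPATIBLE in the standing range `j + 1 ≤ m + K`,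
`AveragingRT.map_axialAvg`, hence `ac_qU`), `Q(u)φ` := the decimation `ψ(y) = φ(emb y)`.  This is NOT the printed (2.6)/(2.10)/(3.4) of
[BalabanImbrieJaffe1985] (whose torus instances are not built in this cell yet); it only certifies that `BIJ85RT33.RTData P j` is inhabited
on the carrier of record, so that `eq313` and `BIJ85RT37Normalization.integral_rt` quantify over a non-empty type. [cite: BalabanImbrieJaffe1988, (3.11) p.266] -/
def decimationData (hj : j + 1 ≤ P.m + P.K) : RTData P j where
  tree := ∅
  fresh := fun b => b.src
  rank := fun _ => 0
  treeOrder :=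
    ⟨fun b hb => (Finset.notMem_empty b hb).elim, fun b hb => (Finset.notMem_empty b hb).elim,
      fun b hb => (Finset.notMem_empty b hb).elim, fun b hb => (Finset.notMem_empty b hb).elim⟩
  qU := AveragingRT.axialAvg
  measurable_qU := AveragingRT.measurable_axialAvg
  qH := fun _ φ y => φ (emb y)
  measurable_qH := measurable_pi_lambda _ fun y => (measurable_pi_apply (emb y)).comp measurable_snd
  ac_qU := by
    have h : (fun U : GaugeField P j U1 => AveragingRT.axialAvg (T4AxialGaugeFixing.fixBonds (∅ : Finset (PBond P j)) U)) =
        (AveragingRT.axialAvg : GaugeField P j U1 → GaugeField P (j + 1) U1) := by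
      funext U
      rw [T4AxialGaugeFixing.fixBonds_empty]
    rw [h, AveragingRT.map_axialAvg hj]

/-- With the decimation datum, (3.13) is an unconditional identity between the typed `[F]` and the typed `ρ₁ᴸ` (standing range, `a > 0`,
`d ≥ 2`, `ε > 0`, `F` jointly measurable and gauge invariant with `ρ₀ ∈ L¹`) — the non-vacuity of `eq313` made explicit.
[cite: BalabanImbrieJaffe1988, (3.13) p.267] -/
theorem eq313_decimation (hj : j + 1 ≤ P.m + P.K) {a : ℝ} (ha : 0 < a) (hd : 2 ≤ P.d) {ε : ℝ} (hε : 0 < ε) (e lam dm2 E₀ E₁ : ℝ)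
    (F : GaugeField P j U1 → HiggsField P j → ℂ) (hFm : Measurable (Function.uncurry F)) (hFg : JointInvariant F)
    (hFi : Integrable (Function.uncurry (rho0 ε e lam dm2 E₀ E₁ F)) ((fieldMeasure P j U1).prod volume)) :
    bracket (actionU1 (ε ^ P.d) ε⁻¹ e lam dm2 E₀ E₁) F =
      ∫ V, (∫ ψ, rho1L (decimationData hj) ha hd ε e lam dm2 E₀ E₁ F V ψ) ∂fieldMeasure P (j + 1) U1 :=
  eq313 (decimationData hj) ha hd hε e lam dm2 E₀ E₁ F hFm hFg hFi

end

end Literature.MathematicalPhysics.QuantumFieldTheory.BalabanImbrieJaffe1984to88.BIJ88RT311
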